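import Summits.Ventures.LatticeQCDFlow.Exactness.IMHEveryStartRateUnboundedWeights
import HarnessLib

/-!
# The price of an imperfect flow in the two numbers every flow paper prints: `E_q[min(1, w)] = 1 − TV(π, q)` (the overlap) and
# `∫ w² dq = 1 + χ²(π‖q) = 1/ESS` — holding `≤ max(1, w(x))/(1 − TV)`, meeting from `x` `≤ (max(1, w(x)) + 1)/(1 − TV) ≤ (max(1, w(x)) + 1)/ā`,
# rate from `x`: `π(w > M) + (1 − (1 − TV)/max(1, w(x), M))^b`

HONEST FRAMING: exact (Metropolis-corrected) sampling algorithms for lattice gauge theory;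
figures of merit are autocorrelation/cost numbers at stated couplings and volumes; no
continuum-physics claim.

Venture `LatticeQCDFlow` (cell pub-lqcd), topic `Exactness`; FANOUT row 30 (lean-1, GEN-40).  NEW WORK of the cell; the dictionary between
this generation's unbounded-weight files (`…MeetingTimeUnboundedWeights`, `…EveryStartRateUnboundedWeights`: every bound carries the MODEL
constant `c₁ = E_q[min(1, w)]` and the second moment `∫ w² dq`) and the flow literature's diagnostics (named only: the acceptance ∕ overlap of
Albergo–Kanwar–Shanahan 2019 and the importance-sampling effective sample size `ESS = 1/E_q[w²]` of Nicoli et al. 2020; row 2's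
`Exactness/FlowAcceptanceOverlap` has the overlap `m = ∫ min(p, q) = 1 − TV` for densities).  Setting: `q` a probability law (the flow),
`0 < w` measurable with `∫ w dq = 1` (`π = w·q` the target); `TV(π, q) = ½∫|w − 1| dq`; `χ²(π‖q) = ∫(w − 1)² dq`.

* §1 (identities, [ours]) **`integral_min_one_eq_one_sub_tv`** — `∫ min(1, w) dq = 1 − ½∫|w − 1| dq` (`min(1, w) = (1 + w − |w − 1|)/2`);
  **`lintegral_min_one_eq_ofReal_one_sub_tv`** — the same in `ℝ≥0∞`; **`integral_sq_eq_one_add_chiSq`** — `∫ w² dq = 1 + ∫(w − 1)² dq` when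
  `w ∈ L²(q)`; **`lintegral_sq_eq_ofReal_one_add_chiSq`** — the same in `ℝ≥0∞`.
* §3 **`lintegral_imhAcceptMass_target_le_lintegral_min_one`** — THE OVERLAP DOMINATES THE PRINTED ACCEPTANCE: `E_π[A] ≤ E_q[min(1, w)]`
  (Tonelli), and **`lintegral_min_one_sq_le_lintegral_imhAcceptMass_target`** — `E_q[min(1, w)]² ≤ E_π[A]`: `ā ≤ c₁ ≤ √ā`; hence **`inv_imhAcceptMass_le_of_meanAccept`** (`1/A(x) ≤ max(1, w(x))/E_π[A]`) and
  **`crn_chain_lintegral_totalDisagreement_le_detLag_of_meanAccept`** (`E[T] ≤ (max(1, w(x)) + 1)/E_π[A]` from a configuration `x`):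
  **`imh_everyStart_measureReal_sub_abs_le_tail_of_meanAccept`** (`|π(S) − δ_xK^b(S)| ≤ π{w > M} + (1 − ā/max(1, w(x), M))^b`):
  EVERY BOUND OF THIS GENERATION HOLDS WITH THE EQUILIBRIUM ACCEPTANCE RATE `ā = E_π[A]` IN PLACE OF `c₁`.
* §2 (the dictionary applied, [ours]) **`inv_imhAcceptMass_le_of_tv`** — `1/A(x) ≤ max(1, w(x))/(1 − TV(π, q))`: THE ACCEPTANCE FROM `x` IS AT
  LEAST THE OVERLAP PER UNIT WEIGHT; **`crn_chain_lintegral_totalDisagreement_le_detLag_of_tv`** — from a configuration `x`, leading run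
  one update ahead: `E[#{n : X_n ≠ X′_n}] ≤ (max(1, w(x)) + 1)/(1 − TV(π, q))` — THE COUPLING OVERHEAD FROM A CONFIGURATION IS CONTROLLED BY THE
  OVERLAP (≥ the printed acceptance) AND THE STARTING WEIGHT ALONE — no moment of the weight, no supremum; the effective sample size
  `1/(1 + χ²)` enters only beside a stationary run (`…SecondMomentSharp`);
  **`imh_everyStart_measureReal_sub_abs_le_tail_of_tv`** — `|π(S) − δ_xK^b(S)| ≤ π{w > M} + (1 − (1 − TV)/max(1, w(x), M))^b` for every `M`.
Reading (gauge files): for a flow-driven exact gauge sampler the printed equilibrium acceptance bounds the holding times, the coupling time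
of the two-run estimator from any configuration and the every-start convergence rate as displayed — whatever the tail of the weight.
NOT CLAIMED: lower bounds in the same currency; the identification `TV = sup_S |π(S) − q(S)|` (the `L¹` form is used); KL ∕ Rényi versions.
No `sorry`, no new definitions, nothing cited as a fact.
-/

noncomputable section

namespace Summit.Ventures.LatticeQCDFlow.Exactness

open MeasureTheory ProbabilityTheory Function Finset Filter Set
open scoped _root_.ENNReal unitInterval Topology
open Summit.Ventures.LatticeQCDFlow.Scoring

variable {Ω : Type*} [MeasurableSpace Ω] {q : Measure Ω} [IsProbabilityMeasure q] {w : Ω → ℝ}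

/-! ## §1 The identities: overlap = `1 − TV`, second moment = `1 + χ²` -/

omit [IsProbabilityMeasure q] in
/-- The weight of a probability target is `q`-integrable with `∫ w dq = 1`. [ours, bookkeeping] -/
theorem integrable_weight_and_integral_eq_one (hw : Measurable w) (hw0 : ∀ y, 0 < w y)
    [IsProbabilityMeasure (q.withDensity fun y => ENNReal.ofReal (w y))] :
    Integrable w q ∧ ∫ y, w y ∂q = 1 := by
  have h1 : ∫⁻ y, ENNReal.ofReal (w y) ∂q = 1 := by
    have := (measure_univ : (q.withDensity fun y => ENNReal.ofReal (w y)) Set.univ = 1)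
    rwa [withDensity_apply _ MeasurableSet.univ, Measure.restrict_univ] at this
  have hint : Integrable w q := by
    refine ⟨hw.aestronglyMeasurable, ?_⟩
    rw [hasFiniteIntegral_iff_ofReal (ae_of_all _ fun y => (hw0 y).le), h1]
    exact ENNReal.one_lt_top
  refine ⟨hint, ?_⟩
  rw [integral_eq_lintegral_of_nonneg_ae (ae_of_all _ fun y => (hw0 y).le) hw.aestronglyMeasurable, h1, ENNReal.toReal_one]

/-- **THE OVERLAP IS ONE MINUS THE TOTAL VARIATION**: `∫ min(1, w) dq = 1 − ½∫|w − 1| dq`. [ours] -/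
theorem integral_min_one_eq_one_sub_tv (hw : Measurable w) (hw0 : ∀ y, 0 < w y)
    [IsProbabilityMeasure (q.withDensity fun y => ENNReal.ofReal (w y))] :
    ∫ y, min 1 (w y) ∂q = 1 - (1 / 2) * ∫ y, |w y - 1| ∂q := by
  obtain ⟨hint, h1⟩ := integrable_weight_and_integral_eq_one (q := q) hw hw0
  have hpt : (fun y => min 1 (w y)) = fun y => (1 / 2) * ((1 + w y) - |w y - 1|) := by
    funext y
    rcases le_total 1 (w y) with h | h
    · rw [min_eq_left h, abs_of_nonneg (sub_nonneg.2 h)]; ring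
    · rw [min_eq_right h, abs_of_nonpos (sub_nonpos.2 h)]; ring
  have habs : Integrable (fun y => |w y - 1|) q := (hint.sub (integrable_const 1)).abs
  have i1 : Integrable (fun y => 1 + w y) q := (integrable_const 1).add hint
  rw [hpt, integral_const_mul, integral_sub i1 habs, integral_add (integrable_const 1) hint, h1]
  simp
  ring

/-- The same in `ℝ≥0∞`: `∫ min(1, w) dq = ofReal(1 − ½∫|w − 1| dq)`. [ours] -/
theorem lintegral_min_one_eq_ofReal_one_sub_tv (hw : Measurable w) (hw0 : ∀ y, 0 < w y)
    [IsProbabilityMeasure (q.withDensity fun y => ENNReal.ofReal (w y))] :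
    ∫⁻ y, ENNReal.ofReal (min 1 (w y)) ∂q = ENNReal.ofReal (1 - (1 / 2) * ∫ y, |w y - 1| ∂q) := by
  rw [← integral_min_one_eq_one_sub_tv hw hw0, ofReal_integral_eq_lintegral_ofReal]
  · exact Integrable.of_bound (measurable_const.min hw).aestronglyMeasurable 1 (ae_of_all _ fun y => by
      rw [Real.norm_eq_abs, abs_of_pos (lt_min one_pos (hw0 y))]; exact min_le_left _ _)
  · exact ae_of_all _ fun y => (lt_min one_pos (hw0 y)).le

omit [IsProbabilityMeasure q] in
/-- **THE SECOND MOMENT IS ONE PLUS THE `χ²`-DIVERGENCE** (`= 1/ESS`): `∫ w² dq = 1 + ∫(w − 1)² dq` for `w ∈ L²(q)` with `∫ w dq = 1`. [ours] -/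
theorem integral_sq_eq_one_add_chiSq [IsProbabilityMeasure q] (hmem : MemLp w 2 q) (h1 : ∫ y, w y ∂q = 1) :
    ∫ y, w y ^ 2 ∂q = 1 + ∫ y, (w y - 1) ^ 2 ∂q := by
  have hint : Integrable w q := hmem.integrable one_le_two
  have hsq : Integrable (fun y => w y ^ 2) q := hmem.integrable_sq
  have hpt : (fun y => (w y - 1) ^ 2) = fun y => (w y ^ 2 - 2 * w y) + 1 := funext fun y => by ring
  have i2 : Integrable (fun y => 2 * w y) q := hint.const_mul 2
  have i1 : Integrable (fun y => w y ^ 2 - 2 * w y) q := hsq.sub i2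
  rw [hpt, integral_add i1 (integrable_const 1), integral_sub hsq i2, integral_const_mul, h1]
  simp
  ring

omit [IsProbabilityMeasure q] in
/-- The same in `ℝ≥0∞`: `∫ w² dq = ofReal(1 + ∫(w − 1)² dq)`. [ours] -/
theorem lintegral_sq_eq_ofReal_one_add_chiSq [IsProbabilityMeasure q] (hmem : MemLp w 2 q) (h1 : ∫ y, w y ∂q = 1) :
    ∫⁻ y, ENNReal.ofReal (w y ^ 2) ∂q = ENNReal.ofReal (1 + ∫ y, (w y - 1) ^ 2 ∂q) := by
  rw [← integral_sq_eq_one_add_chiSq hmem h1, ofReal_integral_eq_lintegral_ofReal hmem.integrable_sq (ae_of_all _ fun y => sq_nonneg _)]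

/-! ## §2 The dictionary applied -/

/-- **THE ACCEPTANCE FROM `x` IS AT LEAST THE OVERLAP PER UNIT WEIGHT**: `1/A(x) ≤ max(1, w(x))/(1 − TV(π, q))` (`ℝ≥0∞`). [ours] -/
theorem inv_imhAcceptMass_le_of_tv (hw : Measurable w) (hw0 : ∀ y, 0 < w y)
    [IsProbabilityMeasure (q.withDensity fun y => ENNReal.ofReal (w y))] (x : Ω) :
    (imhAcceptMass q w x)⁻¹ ≤ ENNReal.ofReal (max 1 (w x)) / ENNReal.ofReal (1 - (1 / 2) * ∫ y, |w y - 1| ∂q) := by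
  rw [← lintegral_min_one_eq_ofReal_one_sub_tv hw hw0]
  exact inv_imhAcceptMass_le hw0 x

/-- **THE COUPLING OVERHEAD FROM A CONFIGURATION, IN THE OVERLAP** (standard Borel `Ω`, every proposal law, every weight): production run at
`x`, leading run one update ahead (`ν̂ = K(x, ·)∘(y ↦ (y, x))⁻¹`):
`E[#{n : X_n ≠ X′_n}] ≤ (max(1, w(x)) + 1)/(1 − TV(π, q))` — no moment of the weight enters. [ours] -/
theorem crn_chain_lintegral_totalDisagreement_le_detLag_of_tv [StandardBorelSpace Ω] [Nonempty Ω]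
    [MeasurableSingletonClass Ω] [MeasurableEq Ω] (hw : Measurable w) (hw0 : ∀ y, 0 < w y)
    [IsProbabilityMeasure (q.withDensity fun y => ENNReal.ofReal (w y))]
    (Khat : Kernel (Ω × Ω) (Ω × Ω)) [IsMarkovKernel Khat]
    (hK : ∀ z : Ω × Ω, Khat z = (q.prod (volume : Measure unitInterval)).map (fun p : Ω × unitInterval =>
      ((if (p.2 : ℝ) * w z.1 ≤ w p.1 then p.1 else z.1), (if (p.2 : ℝ) * w z.2 ≤ w p.1 then p.1 else z.2))))
    (x : Ω) (ν : Measure (Ω × Ω)) [IsProbabilityMeasure ν] (hν : ν = (indepMH q w x).map fun y : Ω => (y, x)) :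
    ∫⁻ z, (∑' n, (Set.diagonal Ω)ᶜ.indicator (1 : Ω × Ω → ℝ≥0∞) (z n))
        ∂(Kernel.trajMeasure (X := fun _ : ℕ => Ω × Ω) ν
          (fun n : ℕ => Khat.comap (fun h : (i : ↥(Finset.Iic n)) → Ω × Ω => h ⟨n, Finset.mem_Iic.2 le_rfl⟩)
            (measurable_pi_apply _))) ≤
      (ENNReal.ofReal (max 1 (w x)) + 1) / ENNReal.ofReal (1 - (1 / 2) * ∫ y, |w y - 1| ∂q) := by
  rw [← lintegral_min_one_eq_ofReal_one_sub_tv hw hw0]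
  exact crn_chain_lintegral_totalDisagreement_le_detLag_unboundedWeights hw hw0 Khat hK x ν hν

/-- **THE EVERY-START RATE IN DIVERGENCES**: for every level `M`, every `x`, measurable `S` and `b`,
`|π(S) − δ_xK^b(S)| ≤ (π{w > M} + (1 − (1 − TV(π, q))/max(1, w(x), M))^b).toReal`. [ours] -/
theorem imh_everyStart_measureReal_sub_abs_le_tail_of_tv [StandardBorelSpace Ω] [Nonempty Ω] [MeasurableSingletonClass Ω]
    [MeasurableEq Ω] (hw : Measurable w) (hw0 : ∀ y, 0 < w y)
    [IsProbabilityMeasure (q.withDensity fun y => ENNReal.ofReal (w y))] (x : Ω) {S : Set Ω} (hS : MeasurableSet S) (b : ℕ)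
    (M : ℝ) :
    |(q.withDensity fun y => ENNReal.ofReal (w y)).real S -
        ((fun m : Measure Ω => m.bind (indepMH q w))^[b] (Measure.dirac x)).real S| ≤
      ((q.withDensity fun y => ENNReal.ofReal (w y)) {y | M < w y} +
        (1 - ENNReal.ofReal (1 - (1 / 2) * ∫ y, |w y - 1| ∂q) / ENNReal.ofReal (max 1 (max (w x) M))) ^ b).toReal := by
  rw [← lintegral_min_one_eq_ofReal_one_sub_tv hw hw0]
  exact imh_everyStart_measureReal_sub_abs_le_tail hw hw0 x hS b M

/-! ## §3 The overlap dominates the printed equilibrium acceptance -/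

/-- **THE OVERLAP IS AT LEAST THE EQUILIBRIUM ACCEPTANCE**: `E_π[A] = ∫ A dπ ≤ E_q[min(1, w)] = 1 − TV(π, q)` (`ℝ≥0∞`; Tonelli and
`∫ min(w(x), w(y)) q(dx) ≤ min(1, w(y))`) — the model constant `c₁` of this generation's bounds dominates the acceptance rate every flow
paper prints. [ours] -/
theorem lintegral_imhAcceptMass_target_le_lintegral_min_one (hw : Measurable w) (hw0 : ∀ y, 0 < w y)
    [IsProbabilityMeasure (q.withDensity fun y => ENNReal.ofReal (w y))] :
    ∫⁻ x, imhAcceptMass q w x ∂(q.withDensity fun y => ENNReal.ofReal (w y)) ≤ ∫⁻ y, ENNReal.ofReal (min 1 (w y)) ∂q := by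
  have h1 : ∫⁻ z, ENNReal.ofReal (w z) ∂q = 1 := by
    have := (measure_univ : (q.withDensity fun y => ENNReal.ofReal (w y)) Set.univ = 1)
    rwa [withDensity_apply _ MeasurableSet.univ, Measure.restrict_univ] at this
  have hAm : Measurable (imhAcceptMass q w) := measurable_imhAcceptMass q hw
  have hmin : Measurable fun p : Ω × Ω => ENNReal.ofReal (min (w p.1) (w p.2)) :=
    ((hw.comp measurable_fst).min (hw.comp measurable_snd)).ennreal_ofReal
  rw [lintegral_withDensity_eq_lintegral_mul _ hw.ennreal_ofReal hAm]
  calc ∫⁻ x, (fun y => ENNReal.ofReal (w y)) x * imhAcceptMass q w x ∂q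
      = ∫⁻ x, ∫⁻ y, ENNReal.ofReal (min (w x) (w y)) ∂q ∂q := lintegral_congr fun x => ofReal_mul_imhAcceptMass hw0 x
    _ = ∫⁻ y, ∫⁻ x, ENNReal.ofReal (min (w x) (w y)) ∂q ∂q := lintegral_lintegral_swap hmin.aemeasurable
    _ ≤ ∫⁻ y, ENNReal.ofReal (min 1 (w y)) ∂q := by
        refine lintegral_mono fun y => ?_
        rcases le_total 1 (w y) with hy | hy
        · rw [min_eq_left hy, ENNReal.ofReal_one, ← h1]
          exact lintegral_mono fun x => ENNReal.ofReal_le_ofReal (min_le_left _ _)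
        · rw [min_eq_right hy]
          calc ∫⁻ x, ENNReal.ofReal (min (w x) (w y)) ∂q ≤ ∫⁻ _, ENNReal.ofReal (w y) ∂q :=
                lintegral_mono fun x => ENNReal.ofReal_le_ofReal (min_le_right _ _)
            _ = ENNReal.ofReal (w y) := by rw [lintegral_const, measure_univ, mul_one]

/-- **…AND IS AT MOST ITS SQUARE ROOT**: `E_q[min(1, w)]² ≤ E_π[A]` (`min(1, a)·min(1, b) ≤ min(a, b)` and Tonelli) — together with the previous lemma
`ā ≤ c₁ ≤ √ā`: the model constant of this generation IS the printed equilibrium acceptance up to a square root. [ours] -/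
theorem lintegral_min_one_sq_le_lintegral_imhAcceptMass_target (hw : Measurable w) (hw0 : ∀ y, 0 < w y)
    [IsProbabilityMeasure (q.withDensity fun y => ENNReal.ofReal (w y))] :
    (∫⁻ y, ENNReal.ofReal (min 1 (w y)) ∂q) ^ 2 ≤ ∫⁻ x, imhAcceptMass q w x ∂(q.withDensity fun y => ENNReal.ofReal (w y)) := by
  have hAm : Measurable (imhAcceptMass q w) := measurable_imhAcceptMass q hw
  have hm : Measurable fun y : Ω => ENNReal.ofReal (min 1 (w y)) := (measurable_const.min hw).ennreal_ofReal
  have hmin : ∀ {a b : ℝ}, 0 ≤ a → 0 ≤ b → min 1 a * min 1 b ≤ min a b := by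
    intro a b ha hb
    rcases le_total a 1 with ha1 | ha1 <;> rcases le_total b 1 with hb1 | hb1
    · rw [min_eq_right ha1, min_eq_right hb1]
      exact le_min (mul_le_of_le_one_right ha hb1) (mul_le_of_le_one_left hb ha1)
    · rw [min_eq_right ha1, min_eq_left hb1, mul_one]
      exact le_min le_rfl (ha1.trans hb1)
    · rw [min_eq_left ha1, min_eq_right hb1, one_mul]
      exact le_min (hb1.trans ha1) le_rfl
    · rw [min_eq_left ha1, min_eq_left hb1, one_mul]
      exact le_min ha1 hb1
  rw [lintegral_withDensity_eq_lintegral_mul _ hw.ennreal_ofReal hAm, sq, ← lintegral_lintegral_mul hm.aemeasurable hm.aemeasurable]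
  refine lintegral_mono fun x => ?_
  calc ∫⁻ y, ENNReal.ofReal (min 1 (w x)) * ENNReal.ofReal (min 1 (w y)) ∂q
      ≤ ∫⁻ y, ENNReal.ofReal (min (w x) (w y)) ∂q := by
        refine lintegral_mono fun y => ?_
        rw [← ENNReal.ofReal_mul (le_min zero_le_one (hw0 x).le)]
        exact ENNReal.ofReal_le_ofReal (hmin (hw0 x).le (hw0 y).le)
    _ = (fun y => ENNReal.ofReal (w y)) x * imhAcceptMass q w x := (ofReal_mul_imhAcceptMass hw0 x).symm

/-- **THE ACCEPTANCE FROM `x` IS AT LEAST THE EQUILIBRIUM ACCEPTANCE PER UNIT WEIGHT**: `1/A(x) ≤ max(1, w(x))/E_π[A]` (`ℝ≥0∞`): the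
printed acceptance rate of the exact sampler bounds the holding time at every configuration, whatever the tail of the weight. [ours] -/
theorem inv_imhAcceptMass_le_of_meanAccept (hw : Measurable w) (hw0 : ∀ y, 0 < w y)
    [IsProbabilityMeasure (q.withDensity fun y => ENNReal.ofReal (w y))] (x : Ω) :
    (imhAcceptMass q w x)⁻¹ ≤
      ENNReal.ofReal (max 1 (w x)) / ∫⁻ y, imhAcceptMass q w y ∂(q.withDensity fun y => ENNReal.ofReal (w y)) :=
  (inv_imhAcceptMass_le hw0 x).trans
    (ENNReal.div_le_div_left (lintegral_imhAcceptMass_target_le_lintegral_min_one hw hw0) _)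

/-- **THE COUPLING OVERHEAD FROM A CONFIGURATION, IN THE PRINTED ACCEPTANCE RATE** (standard Borel `Ω`, every proposal law, every weight):
`E[#{n : X_n ≠ X′_n}] ≤ (max(1, w(x)) + 1)/E_π[A]` — the equilibrium acceptance rate of the exact sampler and the weight of the starting configuration
are the whole budget; the effective sample size `1/(1 + χ²)` enters only beside a STATIONARY run (`…SecondMomentSharp`). [ours] -/
theorem crn_chain_lintegral_totalDisagreement_le_detLag_of_meanAccept [StandardBorelSpace Ω] [Nonempty Ω]
    [MeasurableSingletonClass Ω] [MeasurableEq Ω] (hw : Measurable w) (hw0 : ∀ y, 0 < w y)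
    [IsProbabilityMeasure (q.withDensity fun y => ENNReal.ofReal (w y))]
    (Khat : Kernel (Ω × Ω) (Ω × Ω)) [IsMarkovKernel Khat]
    (hK : ∀ z : Ω × Ω, Khat z = (q.prod (volume : Measure unitInterval)).map (fun p : Ω × unitInterval =>
      ((if (p.2 : ℝ) * w z.1 ≤ w p.1 then p.1 else z.1), (if (p.2 : ℝ) * w z.2 ≤ w p.1 then p.1 else z.2))))
    (x : Ω) (ν : Measure (Ω × Ω)) [IsProbabilityMeasure ν] (hν : ν = (indepMH q w x).map fun y : Ω => (y, x)) :
    ∫⁻ z, (∑' n, (Set.diagonal Ω)ᶜ.indicator (1 : Ω × Ω → ℝ≥0∞) (z n))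
        ∂(Kernel.trajMeasure (X := fun _ : ℕ => Ω × Ω) ν
          (fun n : ℕ => Khat.comap (fun h : (i : ↥(Finset.Iic n)) → Ω × Ω => h ⟨n, Finset.mem_Iic.2 le_rfl⟩)
            (measurable_pi_apply _))) ≤
      (ENNReal.ofReal (max 1 (w x)) + 1) / ∫⁻ y, imhAcceptMass q w y ∂(q.withDensity fun y => ENNReal.ofReal (w y)) :=
  (crn_chain_lintegral_totalDisagreement_le_detLag_unboundedWeights hw hw0 Khat hK x ν hν).trans
    (ENNReal.div_le_div_left (lintegral_imhAcceptMass_target_le_lintegral_min_one hw hw0) _)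

/-- **THE EVERY-START RATE IN THE PRINTED ACCEPTANCE RATE**: for every level `M`, every `x`, measurable `S` and `b`,
`|π(S) − δ_xK^b(S)| ≤ (π{w > M} + (1 − E_π[A]/max(1, w(x), M))^b).toReal`. [ours] -/
theorem imh_everyStart_measureReal_sub_abs_le_tail_of_meanAccept [StandardBorelSpace Ω] [Nonempty Ω] [MeasurableSingletonClass Ω]
    [MeasurableEq Ω] (hw : Measurable w) (hw0 : ∀ y, 0 < w y)
    [IsProbabilityMeasure (q.withDensity fun y => ENNReal.ofReal (w y))] (x : Ω) {S : Set Ω} (hS : MeasurableSet S) (b : ℕ)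
    (M : ℝ) :
    |(q.withDensity fun y => ENNReal.ofReal (w y)).real S -
        ((fun m : Measure Ω => m.bind (indepMH q w))^[b] (Measure.dirac x)).real S| ≤
      ((q.withDensity fun y => ENNReal.ofReal (w y)) {y | M < w y} +
        (1 - (∫⁻ y, imhAcceptMass q w y ∂(q.withDensity fun y => ENNReal.ofReal (w y))) /
          ENNReal.ofReal (max 1 (max (w x) M))) ^ b).toReal := by
  refine (imh_everyStart_measureReal_sub_abs_le_tail (q := q) hw hw0 x hS b M).trans (ENNReal.toReal_mono ?_ ?_)
  · exact ENNReal.add_ne_top.2 ⟨measure_ne_top _ _,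
      ne_top_of_le_ne_top ENNReal.one_ne_top ((pow_le_pow_left' tsub_le_self b).trans_eq (one_pow b))⟩
  · exact add_le_add le_rfl (pow_le_pow_left' (tsub_le_tsub_left
      (ENNReal.div_le_div_right (lintegral_imhAcceptMass_target_le_lintegral_min_one hw hw0) _) 1) b)

end Summit.Ventures.LatticeQCDFlow.Exactness

end
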